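import Mathlib
import Summits.Ventures.PercRepro2.Defs
import Summits.Ventures.PercRepro2.Harris
import Summits.Ventures.PercRepro2.Independence
import Summits.Ventures.PercRepro2.CoinDefs
import Summits.Ventures.PercRepro2.CoinReverse
import Summits.Ventures.PercRepro2.CoinStarDefs
import Summits.Ventures.PercRepro2.CoinLsmCoreDefs
import Summits.Ventures.PercRepro2.CoinLsmCoreU
import Summits.Ventures.PercRepro2.CoinCoreGate
import Summits.Ventures.PercRepro2.CoinTreeCore
import Summits.Ventures.PercRepro2.CoinOrTailAlg
import Summits.Ventures.PercRepro2.CoinOrTailDefs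
import Summits.Ventures.PercRepro2.CoinOrTailLsmDefs

/-!
# Row 2′DARC at an OR-TAIL on ANY LOG-SUPERMODULAR CORE, I: the branch sums and the markers at
the entries (blind cell PercRepro2, night-2 g9; proofs/NIGHT2-DARC.md §37)

THE GENERAL FORM of §35: a closed-in core `U` of `s` whose cluster law is log-supermodular
(`hν`: for all `W, W' ⊆ U`, `P(level W)·P(level W') ≤ P(level (W ∩ W'))·P(level (W ∪ W'))`), and
a tail `a ∉ U` entered only by `{p → a}`, `{q → a}` (`OrTailU`).
* `OrTailU.sum_R_eq`, `OrTailU.sum_G_eq`: the seven core sums of `ClosedInCoreU.phiC_gate_eq`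
  over `U ∪ {a}` are sums over `U` of `rVal` / `gVal` (the head averaged over the tail coins);
* `OrTailU.head_props`: the head function is nonnegative, decreasing and log-supermodular
  (reversed van den Berg–Kahn);
* `darc_of_orTailLsm`: the markers are the two entries `p, q` — row 2′DARC at `a → w` for
  every head (the diamond certificate lifted by Ahlswede–Daykin, `orTail_functional_nonneg`);
  `darc_of_orTailTree` for an out-tree core; `DARC.symm`.
No branch structure: `p` and `q` may be joined inside `U`.  The core `U ∪ {a}` itself has a
NON-log-supermodular cluster law (the tail is an OR-vertex).  No non-degeneracy hypothesis.
The far-marker forms are in `CoinOrTailLsmCore` (one far marker, certificate `d21_cert`) and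
`CoinOrTailDomCore` (dominating markers, block theorem).
-/

namespace Summit.Ventures.PercRepro2.Coin

open Classical

section OrTailLsmMain

variable {V : Type*} {E : Type*} [Fintype V] [DecidableEq V] [Fintype E] [DecidableEq E]
  {R : Type*} [Field R] [LinearOrder R] [IsStrictOrderedRing R]
  {arcs : E → Finset (V × V)} {s : V} {U : Finset V} {p q a w : V} {cρ cτ : E}


omit [Fintype V] [LinearOrder R] [IsStrictOrderedRing R] in
/-- The `R`-side core sum over `U ∪ {a}` with a marker constant in `a` is the sum over `U` of
`rVal`. -/
lemma OrTailU.sum_R_eq (h : OrTailU arcs s U p q a cρ cτ) (pr : E → R) (t : V)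
    (m : Finset V → R) (hm : ∀ W, m (insert a W) = m W) :
    ∑ W ∈ (insert a U).powerset, prob pr (coreLevel arcs s (insert a U) W) *
        prob pr (coreAvoidEvent arcs s t (insert a U) W) * m W =
      ∑ W ∈ U.powerset, prob pr (coreLevel arcs s U W) *
          rVal (fun X => prob pr (coreAvoidEvent arcs s t (insert a U) X)) p q a
            (pr cρ) (pr cτ) W * m W := by
  rw [Finset.sum_powerset_insert h.a_notin, ← Finset.sum_add_distrib]
  refine Finset.sum_congr rfl fun W hW => ?_
  have hWU : W ⊆ U := Finset.mem_powerset.1 hW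
  have haW : a ∉ W := fun haW => h.a_notin (hWU haW)
  have hins : insert a W = W ∪ {a} := by rw [Finset.insert_eq, Finset.union_comm]
  rw [h.prob_coreLevel_eq pr W, h.prob_coreLevel_eq pr (insert a W),
    prob_tailEvent pr h.ρτ_ne W, prob_tailEvent pr h.ρτ_ne (insert a W), hm W,
    Finset.insert_inter_of_notMem h.a_notin, Finset.inter_eq_left.2 hWU]
  simp only [rVal, tailWt, Finset.mem_insert, haW, h.p_ne_a, h.q_ne_a, false_or, if_false,
    true_or, if_true]
  rw [hins]
  ring

omit [Fintype V] [LinearOrder R] [IsStrictOrderedRing R] in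
/-- The gate-side core sum over `U ∪ {a}` with a marker constant in `a` is the sum over `U` of
`gVal`. -/
lemma OrTailU.sum_G_eq (h : OrTailU arcs s U p q a cρ cτ) (pr : E → R) (t : V)
    (m : Finset V → R) (hm : ∀ W, m (insert a W) = m W) :
    ∑ W ∈ (insert a U).powerset, prob pr (coreLevel arcs s (insert a U) W) *
        prob pr (coreAvoidEvent arcs s t (insert a U) (starTarget a w W)) * m W =
      ∑ W ∈ U.powerset, prob pr (coreLevel arcs s U W) *
          gVal (fun X => prob pr (coreAvoidEvent arcs s t (insert a U) X)) p q a w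
            (pr cρ) (pr cτ) W * m W := by
  rw [Finset.sum_powerset_insert h.a_notin, ← Finset.sum_add_distrib]
  refine Finset.sum_congr rfl fun W hW => ?_
  have hWU : W ⊆ U := Finset.mem_powerset.1 hW
  have haW : a ∉ W := fun haW => h.a_notin (hWU haW)
  have hsw : insert w (insert a W) = W ∪ {a, w} := by
    ext x
    simp only [Finset.mem_insert, Finset.mem_union, Finset.mem_singleton]
    tauto
  have hst1 : starTarget a w W = W := by simp [starTarget, haW]
  have hst2 : starTarget a w (insert a W) = W ∪ {a, w} := by
    simp only [starTarget, Finset.mem_insert_self, if_true]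
    exact hsw
  rw [h.prob_coreLevel_eq pr W, h.prob_coreLevel_eq pr (insert a W),
    prob_tailEvent pr h.ρτ_ne W, prob_tailEvent pr h.ρτ_ne (insert a W), hm W,
    Finset.insert_inter_of_notMem h.a_notin, Finset.inter_eq_left.2 hWU, hst1, hst2]
  simp only [gVal, tailWt, Finset.mem_insert, haW, h.p_ne_a, h.q_ne_a, false_or, if_false,
    true_or, if_true]
  ring

/-- The head function of the core `U ∪ {a}` is nonnegative, decreasing and log-supermodular
(reversed van den Berg–Kahn). -/
lemma OrTailU.head_props (pr : E → R) (hp : IsProbVec pr) (hS : SameEnds arcs) (t : V) :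
    (∀ X : Finset V, 0 ≤ prob pr (coreAvoidEvent arcs s t (insert a U) X)) ∧
    (∀ X Y : Finset V, X ⊆ Y →
      prob pr (coreAvoidEvent arcs s t (insert a U) Y) ≤
        prob pr (coreAvoidEvent arcs s t (insert a U) X)) ∧
    (∀ X Y : Finset V,
      prob pr (coreAvoidEvent arcs s t (insert a U) X) *
        prob pr (coreAvoidEvent arcs s t (insert a U) Y) ≤
      prob pr (coreAvoidEvent arcs s t (insert a U) (X ∩ Y)) *
        prob pr (coreAvoidEvent arcs s t (insert a U) (X ∪ Y))) := by
  refine ⟨fun X => prob_nonneg hp _, ?_, ?_⟩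
  · intro X Y hXY
    apply prob_mono hp
    intro ω hω v hv
    exact hω v (Finset.insert_subset_insert s hXY hv)
  · intro X Y
    have hh := vdBKC_rev pr hp (sameEnds_coreOff (C := insert a U) hS) t ∅ ∅
      (insert s X) (insert s Y)
    have hi : insert s X ∩ insert s Y = insert s (X ∩ Y) := (Finset.insert_inter_distrib X Y s).symm
    have hun : insert s X ∪ insert s Y = insert s (X ∪ Y) := (Finset.insert_union_distrib s X Y).symm
    rw [hi, hun] at hh
    simp only [coreAvoidEvent]
    simpa only [Finset.notMem_empty, false_imp_iff, implies_true, Set.setOf_true, Set.univ_inter,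
      Finset.empty_union] using hh

/-- **THEOREM (row 2′DARC at an OR-tail on a log-supermodular core, every head).**
`OrTailU arcs s U p q a cρ cτ`, `SameEnds`, the cluster law of `U` log-supermodular (`hν`),
`t, w ∉ U ∪ {a, s}` ⟹ `Φ_D({s ↛ t in D + (a → w)}) ≥ 0` for the markers `p, q` (the two
entries of the tail). -/
theorem darc_of_orTailLsm (pr : E → R) (hp : IsProbVec pr) (hS : SameEnds arcs)
    (h : OrTailU arcs s U p q a cρ cτ)
    (hν : ∀ W W', W ⊆ U → W' ⊆ U →
      prob pr (coreLevel arcs s U W) * prob pr (coreLevel arcs s U W') ≤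
        prob pr (coreLevel arcs s U (W ∩ W')) * prob pr (coreLevel arcs s U (W ∪ W')))
    {t : V} (htC : t ∉ insert a U) (hts : t ≠ s) (hws : w ≠ s) (hwC : w ∉ insert a U) :
    DARC pr arcs s {t} p q a w := by
  have hC := h.closedInCoreU
  have hpC : p ∈ insert a U := Finset.mem_insert_of_mem h.p_mem
  have hqC : q ∈ insert a U := Finset.mem_insert_of_mem h.q_mem
  have haC : a ∈ insert a U := Finset.mem_insert_self _ _
  unfold DARC
  rw [hC.phiC_gate_eq pr hS htC hts hpC hqC haC hws hwC]
  have hm1 : ∀ W : Finset V, (fun _ : Finset V => (1 : R)) (insert a W) = (fun _ => (1 : R)) W :=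
    fun _ => rfl
  have hmp : ∀ W : Finset V, (fun W : Finset V => if p ∈ W then (1 : R) else 0) (insert a W) =
      (fun W : Finset V => if p ∈ W then (1 : R) else 0) W := by
    intro W; simp only [Finset.mem_insert, h.p_ne_a, false_or]
  have hmq : ∀ W : Finset V, (fun W : Finset V => if q ∈ W then (1 : R) else 0) (insert a W) =
      (fun W : Finset V => if q ∈ W then (1 : R) else 0) W := by
    intro W; simp only [Finset.mem_insert, h.q_ne_a, false_or]
  have hmpq : ∀ W : Finset V,
      (fun W : Finset V => (if p ∈ W then (1 : R) else 0) * (if q ∈ W then (1 : R) else 0))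
        (insert a W) =
      (fun W : Finset V => (if p ∈ W then (1 : R) else 0) * (if q ∈ W then (1 : R) else 0)) W := by
    intro W; simp only [Finset.mem_insert, h.p_ne_a, h.q_ne_a, false_or]
  have eΛ := h.sum_R_eq pr t (fun _ => (1 : R)) hm1
  have eFa := h.sum_R_eq pr t (fun W => if p ∈ W then (1 : R) else 0) hmp
  have eFb := h.sum_R_eq pr t (fun W => if q ∈ W then (1 : R) else 0) hmq
  have eM := h.sum_G_eq (w := w) pr t (fun _ => (1 : R)) hm1
  have eX := h.sum_G_eq (w := w) pr t (fun W => if p ∈ W then (1 : R) else 0) hmp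
  have eY := h.sum_G_eq (w := w) pr t (fun W => if q ∈ W then (1 : R) else 0) hmq
  have eXY := h.sum_G_eq (w := w) pr t
    (fun W => (if p ∈ W then (1 : R) else 0) * (if q ∈ W then (1 : R) else 0)) hmpq
  simp only [mul_one] at eΛ eM
  rw [eΛ, eFa, eFb, eM, eX, eY, eXY]
  obtain ⟨hA0, hAmono, hAlsm⟩ := OrTailU.head_props (U := U) (a := a) pr hp hS t
  exact orTail_functional_nonneg U (fun W => prob pr (coreLevel arcs s U W))
    (fun X => prob pr (coreAvoidEvent arcs s t (insert a U) X)) p q a w (pr cρ) (pr cτ)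
    h.a_notin (fun hw => hwC (Finset.mem_insert_of_mem hw)) (hp.nonneg cρ) (hp.le_one cρ)
    (hp.nonneg cτ) (hp.le_one cτ) (fun W => prob_nonneg hp _)
    (fun s' hs' t' ht' => hν s' t' hs' ht') hA0 hAlsm hAmono


/-- **COROLLARY (an OR-tail on ONE out-tree).**  `U` an out-tree core (`TreeCore`), `p, q ∈ U`
any two of its vertices — on the SAME branch or not — and the tail `a` attached at both: row
2′DARC at `a → w` for the markers `p, q` at every head.  E.g. the chain `s → p → q` with
`p → a`, `q → a` (the two routes to the tail share the prefix `s → p`). -/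
theorem darc_of_orTailTree (pr : E → R) (hp : IsProbVec pr) (hS : SameEnds arcs)
    (h : OrTailU arcs s U p q a cρ cτ)
    {c : V → E} {par : V → V} {rk : V → ℕ} (hU : TreeCore arcs s U c par rk)
    {t : V} (htC : t ∉ insert a U) (hts : t ≠ s) (hws : w ≠ s) (hwC : w ∉ insert a U) :
    DARC pr arcs s {t} p q a w :=
  darc_of_orTailLsm pr hp hS h (hU.coreLevel_lsm pr hp) htC hts hws hwC

omit [Fintype V] [DecidableEq V] in
/-- The row is symmetric in its two markers (`phiC` is symmetric in `a, b`). -/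
theorem DARC.symm (pr : E → R) {T : Finset V} {a b u : V} (h : DARC pr arcs s T a b u w) :
    DARC pr arcs s T b a u w := by
  unfold DARC phiC at h ⊢
  simp only at h ⊢
  have hxy : (fun ω => marker (R := R) arcs s b ω * marker arcs s a ω) =
      fun ω => marker (R := R) arcs s a ω * marker arcs s b ω := by
    funext ω; ring
  rw [hxy]
  linarith [h]


end OrTailLsmMain

end Summit.Ventures.PercRepro2.Coin
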